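import Summits.QuantumFields.YangMills.Theorems.UnitScaleTiltProp7H46Reality
import Summits.QuantumFields.YangMills.Theorems.UnitScaleTiltProp7SectET3WilsonHessianT3RealityRows
import HarnessLib

/-!
# Route `UnitScaleTilt`, crux K1 child «MinimiserStabilityRegPr» (stmt-QuantumFields-19200), skeleton v10, stub `stub_existenceMinimalOrbit` (EX),
# route (α) — **PRINT'S `H(U₀)` OF `h46tw` MAPS TRACELESS BLOCK DATA TO TRACELESS FIELDS** (the trace half of the knit's (R-H) clause), given the displayed
# sector rows of `Q(U₀) = QTwS U₀` (traceless ↦ traceless = (Q-a); scalar ↦ scalar = (Q-b)) and of `Δ^η_{U₀}`; hence the FULL (R-H) clause and the full `hH₁R` clause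

Cell `ym3-torus`, width seat `ym-ust-20520-w4` (gen 4).  THEOREMS ONLY (0 `def`, 0 `sorry`).  Part (a), part 3 of the ym-inputs-p03 g2 ∕ ★w4-20520 g4 split: the UNITARY case of
✓`Prop7SectET3PropagatorsReality.H46_comm` (`hkind` = jointly unitary) at the REFLECTIONS of the traceless sectors of the three `L²` carriers (Mathlib `Submodule.reflection`; p03's
`reflection_props` idea), the sectors being built INSIDE the proofs (def-free).  Nothing here closes the stub; `--supports stmt-QuantumFields-19200 --as helper`, count-neutral.  YM₃ on T³
is a ladder rung (R3), not the Clay problem; nothing here claims the stub, the crux, d = 4 or the gap.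

THE PRINT.  [Balaban1985BackgroundPropagators] p. 393: `Q_j(U)` «with values in the Lie algebra 𝔤»; the complexification `𝔤ᶜ`; all operators of §3 act on `𝔤ᶜ`-valued functions.  On the cell's
carriers `W₂ ≅ M₂(ℂ) = 𝔰𝔩₂(ℂ) ⊕ ℂ·1` the `𝔤ᶜ = 𝔰𝔩₂`-valuedness of `H(U₀)B` for `𝔰𝔩₂`-valued `B` is the statement that `H(U₀)` preserves the TRACELESS sector — which an operator built from
inverses, adjoints and orthogonal projections of data does as soon as the data preserve the traceless sector AND its orthogonal complement, the SCALAR sector (ym-inputs-p03 g2 memo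
`REALITY-ROWS-LOCATE-p03g2.md` §3: for `Q(U₀)` the scalar row (Q-b) is NOT a consequence of (Q-a)).

WHAT IS PROVED (sorry-free, no definition).
* §1 frame-free: `reflection_comm_of_mapsTo` (`T(V) ⊆ V′`, `T(Vᗮ) ⊆ V′ᗮ` ⟹ `T ∘ ρ_V = ρ_{V′} ∘ T`), `mapsTo_orthogonal_of_adjoint` (`T†(V′) ⊆ V ⟹ T(Vᗮ) ⊆ V′ᗮ`),
  `exists_smul_one_of_trace_orthogonal` (`(𝔰𝔩₂)^⊥ = ℂ·1` in `M₂(ℂ)` for `tr(XᴴU)`).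
* §2 the carriers: `trace_DstarL2_apply_eq_zero` (`D*_{U₀}` preserves traceless), and the (R-H) trace half ★★★`trace_H46_eq_zero_of_traceless` under the displayed rows
  `hQtr`∕`hQsc` (the two `QTwS` sectors) and `hΔtr` (the traceless sector of `Δ^η`; its scalar sector follows from p01's ✓`DeltaEta_isSymmetric`); ★★★`H46_skewHermitian_traceless` = the knit's (R-H) clause for `H := H46 U₀` VERBATIM
  (`∀ Y, (∀ c, star (Y c) = −Y c ∧ tr (Y c) = 0) → ∀ b, star (H Y b) = −H Y b ∧ tr (H Y b) = 0`) from part 2's `star` half + this trace half.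

References: T. Bałaban, CMP 99 (1985) 389–434 [Balaban1985BackgroundPropagators] (p.393, (3.21) p.394, (3.126) p.420); CMP 102 (1985) 277–309 [Balaban1985Variational] ((45)–(46) p.285, (51) p.286).
-/

set_option autoImplicit false

noncomputable section

open scoped InnerProductSpace ComplexConjugate Matrix.Norms.L2Operator BigOperators

namespace Summit.QuantumFields.YangMills.Theorems.Prop7H46RealityTrace

open Literature.MathematicalPhysics.QuantumFieldTheory.Balaban1983to89
open Literature.MathematicalPhysics.QuantumFieldTheory.Balaban1983to89.T3ContinuumYM3Torus
open T3SectALandauChart (eta)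
open B9SectCLatticeCarrier (Bond)
open B9Eq311L2Pairing (WL2)
open B11Eq103H1Complex (SiteL2K BondL2K)
open Summit.QuantumFields.YangMills.Theorems.Prop7SectET3Transport (periodsT3 siteEquiv bondEquiv bgOfCfg)
open Summit.QuantumFields.YangMills.Theorems.Prop7SectET3HilbertLetters (W₂ frobEquiv toL2 toL2S toL2B QL2 DL2 DstarL2 QL2_toL2 inner_toL2 inner_toL2B adjoint_DL2 DstarL2_apply)
open Summit.QuantumFields.YangMills.Theorems.Prop7SectET3WilsonHessian (DeltaEta DeltaEta_isSymmetric)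
open Summit.QuantumFields.YangMills.Theorems.Prop7SectET3DeltaPi (DeltaPiSlot H46)
open Summit.QuantumFields.YangMills.Theorems.Prop7SymAvgTwSym (QTwS)
open Summit.QuantumFields.YangMills.Theorems.Prop7SectET3PropagatorsReality (H46_comm)
open Summit.QuantumFields.YangMills.Theorems.Prop7SectET3HilbertLettersReality (trace_DL2_apply_eq_zero)
open Summit.QuantumFields.YangMills.Theorems.Prop7H46Reality (star_H46_eq_neg_of_skew)

/-! ## §1 Frame-free: reflections of sectors, adjoints, and `(𝔰𝔩₂)^⊥ = ℂ·1` -/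

section FrameFree

variable {E F : Type*} [NormedAddCommGroup E] [InnerProductSpace ℂ E] [NormedAddCommGroup F] [InnerProductSpace ℂ F]

/-- **A LINEAR MAP RESPECTING A SECTOR AND ITS COMPLEMENT INTERTWINES THE REFLECTIONS**: `T(V) ⊆ V′`, `T(Vᗮ) ⊆ V′ᗮ` ⟹ `T(ρ_V x) = ρ_{V′}(T x)`.
[cite: Balaban1985BackgroundPropagators, p.393; Balaban1985Variational, (51) p.286] -/
theorem reflection_comm_of_mapsTo (V : Submodule ℂ E) (V' : Submodule ℂ F) [V.HasOrthogonalProjection] [V'.HasOrthogonalProjection] (T : E →ₗ[ℂ] F)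
    (hV : ∀ v ∈ V, T v ∈ V') (hV' : ∀ u ∈ Vᗮ, T u ∈ V'ᗮ) (x : E) : T (V.reflection x) = V'.reflection (T x) := by
  have hP : V'.starProjection (T x) = T (V.starProjection x) := by
    have hx : T x = T (V.starProjection x) + T (x - V.starProjection x) := by rw [← map_add, add_sub_cancel]
    rw [hx, map_add, Submodule.starProjection_eq_self_iff.2 (hV _ (V.starProjection_apply_mem x)),
      V'.starProjection_apply_eq_zero_iff.2 (hV' _ (V.sub_starProjection_mem_orthogonal x)), add_zero]
  rw [Submodule.reflection_apply, Submodule.reflection_apply, map_sub, two_smul, two_smul, map_add, hP]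

/-- **`T†(V′) ⊆ V ⟹ T(Vᗮ) ⊆ V′ᗮ`** (the complementary sector through the adjoint). [cite: Balaban1985BackgroundPropagators, p.391, p.393] -/
theorem mapsTo_orthogonal_of_adjoint [FiniteDimensional ℂ E] [FiniteDimensional ℂ F] (T : E →ₗ[ℂ] F) (V : Submodule ℂ E) (V' : Submodule ℂ F)
    (h : ∀ v ∈ V', LinearMap.adjoint T v ∈ V) {u : E} (hu : u ∈ Vᗮ) : T u ∈ V'ᗮ := by
  rw [Submodule.mem_orthogonal]
  intro v hv
  rw [← LinearMap.adjoint_inner_left]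
  exact Submodule.inner_right_of_mem_orthogonal (h v hv) hu

/-- **`(𝔰𝔩₂)^⊥ = ℂ·1` IN `M₂(ℂ)` FOR THE FROBENIUS PAIRING `tr(XᴴU)`**: a matrix orthogonal to every traceless matrix is scalar. [folklore] -/
theorem exists_smul_one_of_trace_orthogonal (U : Matrix (Fin 2) (Fin 2) ℂ) (hU : ∀ X : Matrix (Fin 2) (Fin 2) ℂ, X.trace = 0 → (X.conjTranspose * U).trace = 0) :
    ∃ c : ℂ, U = c • (1 : Matrix (Fin 2) (Fin 2) ℂ) := by
  have h01 := hU !![0, 1; 0, 0] (by simp [Matrix.trace_fin_two])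
  have h10 := hU !![0, 0; 1, 0] (by simp [Matrix.trace_fin_two])
  have hdg := hU !![1, 0; 0, -1] (by simp [Matrix.trace_fin_two])
  simp [Matrix.trace_fin_two, Matrix.mul_apply, Fin.sum_univ_two, Matrix.conjTranspose_apply] at h01 h10 hdg
  refine ⟨U 0 0, ?_⟩
  ext i j
  fin_cases i <;> fin_cases j
  · simp
  · simp [h01]
  · simp [h10]
  · simp only [Matrix.smul_apply, Matrix.one_apply_eq, smul_eq_mul, mul_one, Fin.mk_one, Fin.isValue]
    exact (sub_eq_zero.1 hdg).symm

/-- Conversely a scalar matrix is Frobenius-orthogonal to every traceless matrix. [folklore] -/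
theorem trace_conjTranspose_mul_smul_one {X : Matrix (Fin 2) (Fin 2) ℂ} (hX : X.trace = 0) (c : ℂ) : (X.conjTranspose * (c • (1 : Matrix (Fin 2) (Fin 2) ℂ))).trace = 0 := by
  rw [Matrix.mul_smul, Matrix.mul_one, Matrix.trace_smul, Matrix.trace_conjTranspose, hX, star_zero, smul_zero]

end FrameFree

/-! ## §2 The carriers: `D*` preserves the traceless sector; the trace half of (R-H) -/

variable (F : T3Family) (n K : ℕ) (h : n ≤ K) (c₀ cB a : ℝ) [Fact (0 < c₀)] [Fact (0 < cB)]

omit [Fact (0 < cB)] in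
/-- **`D*_{U₀}` MAPS TRACELESS VECTOR FIELDS TO TRACELESS GAUGE PARAMETERS**: `tr(W⁻¹AW − A′) = tr A − tr A′` in the stencil (3.8) (✓`DstarL2_apply`).
[cite: Balaban1985BackgroundPropagators, (3.8) p.392, p.393] -/
theorem trace_DstarL2_apply_eq_zero (U₀ : GaugeField (F.P K) 0 (Matrix.specialUnitaryGroup (Fin 2) ℂ)) (A : PBond (F.P K) 0 → Matrix (Fin 2) (Fin 2) ℂ)
    (hA : ∀ b, (A b).trace = 0) (x : Site (F.P K) 0) : ((toL2S F K c₀).symm (DstarL2 F n K c₀ U₀ (toL2 F K c₀ A)) x).trace = 0 := by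
  rw [DstarL2_apply, Matrix.trace_smul, Matrix.trace_sum]
  refine smul_eq_zero_of_right _ (Finset.sum_eq_zero fun μ _ => ?_)
  rw [Matrix.trace_sub, Matrix.trace_units_conj', hA, hA, sub_zero]

/-- ★★★ **PRINT'S `H(U₀)` OF `h46tw` MAPS TRACELESS BLOCK DATA TO TRACELESS FIELDS** — given the displayed sector rows of `QTwS U₀` (`hQtr` = (Q-a): traceless ↦ traceless; `hQsc` = (Q-b):
scalar ↦ scalar) and the traceless sector of `Δ^η_{U₀}` read through `toL2` (`hΔtr`; the scalar sector is automatic: `Δ^η` is Hermitian, p01 ✓`DeltaEta_isSymmetric`): `tr Y(c) = 0 ∀ c ⟹ tr (H46 U₀ Y)(b) = 0 ∀ b`.  Proof: ✓`H46_comm` (UNITARY kind) at the reflections of the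
traceless sectors of the three `L²` carriers; the data `D_{U₀}` (p03 `trace_DL2_apply_eq_zero` + `trace_DstarL2_apply_eq_zero` via the adjoint), `Q(U₀)`, `Δ^η` respect sector and complement.
[cite: Balaban1985BackgroundPropagators, (3.126) p.420, p.393; Balaban1985Variational, (45)–(46) p.285, (51) p.286] -/
theorem trace_H46_eq_zero_of_traceless (U₀ : GaugeField (F.P K) 0 (Matrix.specialUnitaryGroup (Fin 2) ℂ))
    (hQtr : ∀ A : PBond (F.P K) 0 → Matrix (Fin 2) (Fin 2) ℂ, (∀ b, (A b).trace = 0) → ∀ c, (QTwS F n K h U₀ A c).trace = 0)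
    (hQsc : ∀ c : PBond (F.P K) 0 → ℂ, ∃ d : PBond (F.P n) 0 → ℂ, QTwS F n K h U₀ (fun b => c b • (1 : Matrix (Fin 2) (Fin 2) ℂ)) = fun c' => d c' • 1)
    (hΔtr : ∀ A : PBond (F.P K) 0 → Matrix (Fin 2) (Fin 2) ℂ, (∀ b, (A b).trace = 0) → ∀ b, ((toL2 F K c₀).symm (DeltaEta F n K c₀ U₀ (toL2 F K c₀ A)) b).trace = 0)
    (Y : PBond (F.P n) 0 → Matrix (Fin 2) (Fin 2) ℂ) (hY : ∀ c, (Y c).trace = 0) (b : PBond (F.P K) 0) :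
    (H46 F n K h c₀ cB a U₀ Y b).trace = 0 := by
  -- the traceless sectors of the three carriers
  let VE : Submodule ℂ (BondL2K ℂ 3 (periodsT3 F K) c₀ W₂) :=
    { carrier := {f | ∀ b, ((toL2 F K c₀).symm f b).trace = 0}
      add_mem' := fun {f g} hf hg b => by rw [map_add, Pi.add_apply, Matrix.trace_add, hf b, hg b, add_zero]
      zero_mem' := fun b => by rw [map_zero, Pi.zero_apply, Matrix.trace_zero]
      smul_mem' := fun r f hf b => by rw [map_smul, Pi.smul_apply, Matrix.trace_smul, hf b, smul_zero] }
  let VS : Submodule ℂ (SiteL2K ℂ 3 (periodsT3 F K) c₀ W₂) :=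
    { carrier := {g | ∀ x, ((toL2S F K c₀).symm g x).trace = 0}
      add_mem' := fun {f g} hf hg x => by rw [map_add, Pi.add_apply, Matrix.trace_add, hf x, hg x, add_zero]
      zero_mem' := fun x => by rw [map_zero, Pi.zero_apply, Matrix.trace_zero]
      smul_mem' := fun r f hf x => by rw [map_smul, Pi.smul_apply, Matrix.trace_smul, hf x, smul_zero] }
  let VF : Submodule ℂ (WL2 ℂ (fun _ : PBond (F.P n) 0 => cB) W₂) :=
    { carrier := {y | ∀ c, ((toL2B F n cB).symm y c).trace = 0}
      add_mem' := fun {f g} hf hg c => by rw [map_add, Pi.add_apply, Matrix.trace_add, hf c, hg c, add_zero]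
      zero_mem' := fun c => by rw [map_zero, Pi.zero_apply, Matrix.trace_zero]
      smul_mem' := fun r f hf c => by rw [map_smul, Pi.smul_apply, Matrix.trace_smul, hf c, smul_zero] }
  haveI : CompleteSpace VE := FiniteDimensional.complete ℂ VE
  haveI : CompleteSpace VS := FiniteDimensional.complete ℂ VS
  haveI : CompleteSpace VF := FiniteDimensional.complete ℂ VF
  -- membership through the route-carrier readings
  have memVE : ∀ A : PBond (F.P K) 0 → Matrix (Fin 2) (Fin 2) ℂ, toL2 F K c₀ A ∈ VE ↔ ∀ b, (A b).trace = 0 := fun A => by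
    change (∀ b, ((toL2 F K c₀).symm (toL2 F K c₀ A) b).trace = 0) ↔ _
    rw [LinearEquiv.symm_apply_apply]
  have memVF : ∀ B : PBond (F.P n) 0 → Matrix (Fin 2) (Fin 2) ℂ, toL2B F n cB B ∈ VF ↔ ∀ c, (B c).trace = 0 := fun B => by
    change (∀ c, ((toL2B F n cB).symm (toL2B F n cB B) c).trace = 0) ↔ _
    rw [LinearEquiv.symm_apply_apply]
  -- the complements: scalar-valued fields (both directions on `E`, one on `F`)
  have scalar_mem_VEc : ∀ c : PBond (F.P K) 0 → ℂ, toL2 F K c₀ (fun b => c b • (1 : Matrix (Fin 2) (Fin 2) ℂ)) ∈ VEᗮ := by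
    intro c
    rw [Submodule.mem_orthogonal]
    intro v hv
    obtain ⟨A, rfl⟩ : ∃ A, v = toL2 F K c₀ A := ⟨(toL2 F K c₀).symm v, ((toL2 F K c₀).apply_symm_apply v).symm⟩
    rw [inner_toL2]
    refine mul_eq_zero_of_right _ (Finset.sum_eq_zero fun b _ => trace_conjTranspose_mul_smul_one ((memVE A).1 hv b) (c b))
  have scalar_mem_VFc : ∀ d : PBond (F.P n) 0 → ℂ, toL2B F n cB (fun c => d c • (1 : Matrix (Fin 2) (Fin 2) ℂ)) ∈ VFᗮ := by
    intro d
    rw [Submodule.mem_orthogonal]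
    intro v hv
    obtain ⟨B, rfl⟩ : ∃ B, v = toL2B F n cB B := ⟨(toL2B F n cB).symm v, ((toL2B F n cB).apply_symm_apply v).symm⟩
    rw [inner_toL2B]
    refine mul_eq_zero_of_right _ (Finset.sum_eq_zero fun c _ => trace_conjTranspose_mul_smul_one ((memVF B).1 hv c) (d c))
  have exists_scalar_of_mem_VEc : ∀ u ∈ VEᗮ, ∃ c : PBond (F.P K) 0 → ℂ, u = toL2 F K c₀ (fun b => c b • (1 : Matrix (Fin 2) (Fin 2) ℂ)) := by
    intro u hu
    obtain ⟨A, rfl⟩ : ∃ A, u = toL2 F K c₀ A := ⟨(toL2 F K c₀).symm u, ((toL2 F K c₀).apply_symm_apply u).symm⟩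
    have hpt : ∀ b, ∃ c : ℂ, A b = c • (1 : Matrix (Fin 2) (Fin 2) ℂ) := by
      intro b
      refine exists_smul_one_of_trace_orthogonal (A b) fun X hX => ?_
      have hmem : toL2 F K c₀ (Pi.single b X) ∈ VE := (memVE _).2 fun b' => by
        by_cases hb : b' = b
        · subst hb; rw [Pi.single_eq_same]; exact hX
        · rw [Pi.single_eq_of_ne hb, Matrix.trace_zero]
      have h0 := (Submodule.mem_orthogonal _ _).1 hu _ hmem
      rw [inner_toL2, Finset.sum_eq_single b (fun b' _ hb' => by rw [Pi.single_eq_of_ne hb', Matrix.conjTranspose_zero, Matrix.zero_mul, Matrix.trace_zero])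
        (fun hb => (hb (Finset.mem_univ b)).elim), Pi.single_eq_same] at h0
      have hc₀ : ((c₀ : ℝ) : ℂ) ≠ 0 := Complex.ofReal_ne_zero.2 (ne_of_gt (Fact.out : 0 < c₀))
      exact (mul_eq_zero.1 h0).resolve_left hc₀
    choose c hc using hpt
    exact ⟨c, congrArg _ (funext hc)⟩
  -- DATA ROWS in sector form
  have hD_V : ∀ g ∈ VS, DL2 F n K c₀ U₀ g ∈ VE := by
    intro g hg
    obtain ⟨l, rfl⟩ : ∃ l, g = toL2S F K c₀ l := ⟨(toL2S F K c₀).symm g, ((toL2S F K c₀).apply_symm_apply g).symm⟩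
    have hl : ∀ x, (l x).trace = 0 := fun x => by have := hg x; rwa [LinearEquiv.symm_apply_apply] at this
    exact fun b' => trace_DL2_apply_eq_zero U₀ l hl b'
  have hDstar_V : ∀ f ∈ VE, LinearMap.adjoint (DL2 F n K c₀ U₀) f ∈ VS := by
    intro f hf
    obtain ⟨A, rfl⟩ : ∃ A, f = toL2 F K c₀ A := ⟨(toL2 F K c₀).symm f, ((toL2 F K c₀).apply_symm_apply f).symm⟩
    rw [adjoint_DL2]
    exact fun x => trace_DstarL2_apply_eq_zero F n K c₀ U₀ A ((memVE A).1 hf) x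
  have hD_Vc : ∀ u ∈ VSᗮ, DL2 F n K c₀ U₀ u ∈ VEᗮ := fun u hu => mapsTo_orthogonal_of_adjoint _ VS VE hDstar_V hu
  have hQ_V : ∀ f ∈ VE, QL2 F n K h c₀ cB U₀ f ∈ VF := by
    intro f hf
    obtain ⟨A, rfl⟩ : ∃ A, f = toL2 F K c₀ A := ⟨(toL2 F K c₀).symm f, ((toL2 F K c₀).apply_symm_apply f).symm⟩
    rw [QL2_toL2]
    exact (memVF _).2 (hQtr A ((memVE A).1 hf))
  have hQ_Vc : ∀ u ∈ VEᗮ, QL2 F n K h c₀ cB U₀ u ∈ VFᗮ := by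
    intro u hu
    obtain ⟨c, rfl⟩ := exists_scalar_of_mem_VEc u hu
    obtain ⟨d, hd⟩ := hQsc c
    rw [QL2_toL2, hd]
    exact scalar_mem_VFc d
  have hΔ_V : ∀ f ∈ VE, (DeltaEta F n K c₀ U₀ : BondL2K ℂ 3 (periodsT3 F K) c₀ W₂ →ₗ[ℂ] BondL2K ℂ 3 (periodsT3 F K) c₀ W₂) f ∈ VE := by
    intro f hf
    obtain ⟨A, rfl⟩ : ∃ A, f = toL2 F K c₀ A := ⟨(toL2 F K c₀).symm f, ((toL2 F K c₀).apply_symm_apply f).symm⟩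
    exact fun b' => hΔtr A ((memVE A).1 hf) b'
  -- `Δ^η` is Hermitian (p01 ✓`DeltaEta_isSymmetric`), so it preserves the complement of every sector it preserves
  have hΔ_Vc : ∀ u ∈ VEᗮ, (DeltaEta F n K c₀ U₀ : BondL2K ℂ 3 (periodsT3 F K) c₀ W₂ →ₗ[ℂ] BondL2K ℂ 3 (periodsT3 F K) c₀ W₂) u ∈ VEᗮ := fun u hu =>
    mapsTo_orthogonal_of_adjoint _ VE VE (fun v hv => by rw [(DeltaEta_isSymmetric U₀).adjoint_eq]; exact hΔ_V v hv) hu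
  -- the reflections intertwined by the data
  have hD : ∀ s, DL2 F n K c₀ U₀ (VS.reflection s) = VE.reflection (DL2 F n K c₀ U₀ s) := reflection_comm_of_mapsTo VS VE _ hD_V hD_Vc
  have hQ : ∀ x, QL2 F n K h c₀ cB U₀ (VE.reflection x) = VF.reflection (QL2 F n K h c₀ cB U₀ x) := reflection_comm_of_mapsTo VE VF _ hQ_V hQ_Vc
  have hΔη : ∀ x, DeltaEta F n K c₀ U₀ (VE.reflection x) = VE.reflection (DeltaEta F n K c₀ U₀ x) := fun x => by
    have := reflection_comm_of_mapsTo VE VE _ hΔ_V hΔ_Vc x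
    simpa only [ContinuousLinearMap.coe_coe] using this
  -- part 1 at the unitary (reflection) triple
  have key := H46_comm F n K h c₀ cB a U₀ (fun x => VE.reflection x) (fun s => VS.reflection s) (fun y => VF.reflection y)
    (Or.inr ⟨fun x y => VE.reflection.inner_map_map x y, fun x y => VS.reflection.inner_map_map x y, fun x y => VF.reflection.inner_map_map x y⟩)
    (fun x y => map_add _ x y) (fun x y => map_add _ x y) (fun x y => map_add _ x y)
    (fun x => VE.reflection_reflection x) (fun s => VS.reflection_reflection s) (fun y => VF.reflection_reflection y)
    (fun r x => map_smul _ _ x) (fun r s => map_smul _ _ s) (fun r y => map_smul _ _ y) hD hQ hΔη Y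
  -- traceless data are fixed by `ρ_{V_F}`; hence `toL2 (H Y)` is fixed by `ρ_{V_E}`, i.e. traceless
  have hYmem : toL2B F n cB Y ∈ VF := (memVF Y).2 hY
  rw [Submodule.reflection_mem_subspace_eq_self hYmem, LinearEquiv.symm_apply_apply] at key
  have hfix : VE.reflection (toL2 F K c₀ (H46 F n K h c₀ cB a U₀ Y)) = toL2 F K c₀ (H46 F n K h c₀ cB a U₀ Y) := by
    have := congrArg (toL2 F K c₀) key
    rw [LinearEquiv.apply_symm_apply] at this
    exact this.symm
  exact (memVE _).1 ((Submodule.reflection_eq_self_iff _).1 hfix) b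

/-- ★★★ **THE KNIT'S (R-H) CLAUSE FOR `H := H46 U₀`, VERBATIM** — skew-Hermitian traceless block data give a skew-Hermitian traceless field — from part 2's `star` half
(✓`Prop7H46Reality.star_H46_eq_neg_of_skew`, rows `hQ`, `hΔη`) and the trace half above (rows `hQtr`, `hQsc`, `hΔtr`).
[cite: Balaban1985Variational, (45)–(46) p.285, (51) p.286; Balaban1985BackgroundPropagators, (3.126) p.420, p.393] -/
theorem H46_skewHermitian_traceless (U₀ : GaugeField (F.P K) 0 (Matrix.specialUnitaryGroup (Fin 2) ℂ))
    (hQ : ∀ A : PBond (F.P K) 0 → Matrix (Fin 2) (Fin 2) ℂ, QTwS F n K h U₀ (star A) = star (QTwS F n K h U₀ A))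
    (hΔη : ∀ f : BondL2K ℂ 3 (periodsT3 F K) c₀ W₂, DeltaEta F n K c₀ U₀ (toL2 F K c₀ (star ((toL2 F K c₀).symm f))) = toL2 F K c₀ (star ((toL2 F K c₀).symm (DeltaEta F n K c₀ U₀ f))))
    (hQtr : ∀ A : PBond (F.P K) 0 → Matrix (Fin 2) (Fin 2) ℂ, (∀ b, (A b).trace = 0) → ∀ c, (QTwS F n K h U₀ A c).trace = 0)
    (hQsc : ∀ c : PBond (F.P K) 0 → ℂ, ∃ d : PBond (F.P n) 0 → ℂ, QTwS F n K h U₀ (fun b => c b • (1 : Matrix (Fin 2) (Fin 2) ℂ)) = fun c' => d c' • 1)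
    (hΔtr : ∀ A : PBond (F.P K) 0 → Matrix (Fin 2) (Fin 2) ℂ, (∀ b, (A b).trace = 0) → ∀ b, ((toL2 F K c₀).symm (DeltaEta F n K c₀ U₀ (toL2 F K c₀ A)) b).trace = 0) :
    ∀ Y : PBond (F.P n) 0 → Matrix (Fin 2) (Fin 2) ℂ, (∀ c, star (Y c) = -Y c ∧ (Y c).trace = 0) →
      ∀ b, star (H46 F n K h c₀ cB a U₀ Y b) = -H46 F n K h c₀ cB a U₀ Y b ∧ (H46 F n K h c₀ cB a U₀ Y b).trace = 0 :=
  fun Y hY b => ⟨star_H46_eq_neg_of_skew F n K h c₀ cB a U₀ hQ hΔη Y (fun c => (hY c).1) b,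
    trace_H46_eq_zero_of_traceless F n K h c₀ cB a U₀ hQtr hQsc hΔtr Y (fun c => (hY c).2) b⟩

end Summit.QuantumFields.YangMills.Theorems.Prop7H46RealityTrace

end
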